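import Literature.Analysis.FluidPDE.StokesTorusProofs
import Literature.Analysis.FunctionSpaces.TorusTestFunction

/-!
# Stub `stub_gpAdmissible` of line `lojasiewicz-lamb-floor-ladder` (crux stmt-AnomalousDissipation-13038)

Admissibility of the Galloway–Proctor force of the crux
`TaylorCertificates.SteadyStatesLoudBounded`: the field
`f_GP(x) = sin(2πx₂)e₀ + sin(2πx₀)e₁ + sin(2πx₁)e₂` on `T³`, written (as in the skeleton of the line
and in route `FrustratedForces`) as the inline sum of the three Stokes modes
`Torus.stokesMode k a false x = sin(2π k·x) a` with `(k, a) = (e₂, e₀), (e₀, e₁), (e₁, e₂)`, is smooth,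
divergence free and mean zero.  Each mode is smooth (`Torus.isSmooth_stokesMode`), divergence free
because `k · a = 0` (`Torus.isDivFree_stokesMode`), and mean zero because `k ≠ 0`
(`Torus.hasZeroMean_stokesMode`); the three properties are additive on smooth fields
(`IsSmooth.add`; the divergence of a `C¹` field is the trace of its torus Fréchet derivative,
`Torus.divergence_eq_trace_fderiv`, which is additive, `Torus.fderiv_add`; `integral_add`).
-/

-- `Summit.<Summit>.<Problem>` is the tree's mandated summit-side namespace (CONVENTIONS §2); for this
-- single-conjunct summit the two coincide, so the duplicate is deliberate.
set_option linter.dupNamespace false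

noncomputable section

namespace Summit.AnomalousDissipation.AnomalousDissipation.Theorems.SteadyStatesLoudBounded.GpAdmissible

open MeasureTheory Filter Topology UnitAddTorus
open scoped InnerProductSpace ENNReal
open Literature.Analysis.FunctionSpaces Literature.Analysis.FluidPDE

/-! ## Additivity of divergence-freeness and of the zero-mean property -/

-- adapted from Literature/Analysis/FunctionSpaces/TorusLerayHelmholtz.lean (`divergence_sub`)
/-- The divergence is additive on `C¹` vector fields of `T³` (trace of the additive torus Fréchet
derivative). [folklore] -/
theorem divergence_add_apply {u v : UnitAddTorus (Fin 3) → EuclideanSpace ℝ (Fin 3)}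
    (hu : Torus.IsContDiff 1 u) (hv : Torus.IsContDiff 1 v) (x : UnitAddTorus (Fin 3)) :
    Torus.divergence (fun y => u y + v y) x = Torus.divergence u x + Torus.divergence v x := by
  rw [show (fun y => u y + v y) = u + v from rfl, Torus.divergence_eq_trace_fderiv (hu.add hv),
    Torus.divergence_eq_trace_fderiv hu, Torus.divergence_eq_trace_fderiv hv, Torus.fderiv_add hu hv,
    ContinuousLinearMap.toLinearMap_add, map_add]

/-- Sums of smooth divergence-free fields of `T³` are divergence free. [folklore] -/
theorem isDivFree_add {u v : UnitAddTorus (Fin 3) → EuclideanSpace ℝ (Fin 3)}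
    (hu : Torus.IsSmooth u) (hv : Torus.IsSmooth v) (hud : Torus.IsDivFree u)
    (hvd : Torus.IsDivFree v) : Torus.IsDivFree (fun y => u y + v y) := fun x => by
  rw [divergence_add_apply (hu.isContDiff (by simp)) (hv.isContDiff (by simp)), hud x, hvd x, add_zero]

/-- Sums of smooth mean-zero fields of `T³` have zero mean. [folklore] -/
theorem hasZeroMean_add {u v : UnitAddTorus (Fin 3) → EuclideanSpace ℝ (Fin 3)}
    (hu : Torus.IsSmooth u) (hv : Torus.IsSmooth v) (hu0 : Torus.HasZeroMean u)
    (hv0 : Torus.HasZeroMean v) : Torus.HasZeroMean (fun y => u y + v y) := by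
  unfold Torus.HasZeroMean at hu0 hv0 ⊢
  rw [integral_add hu.integrable hv.integrable, hu0, hv0, add_zero]

/-! ## The three Stokes modes of the Galloway–Proctor force -/

/-- The frequencies `eⱼ = Pi.single j 1 ∈ ℤ³` are nonzero. [folklore] -/
theorem single_ne_zero (j : Fin 3) : (Pi.single j (1 : ℤ) : Fin 3 → ℤ) ≠ 0 := by
  intro h
  have := congr_fun h j
  simp at this

/-- Transversality `k · a = 0` of the three modes: `⟪e_j, e_i⟫ = 0` for `i ≠ j`. [folklore] -/
theorem inner_latticeVec_single_eq_zero {i j : Fin 3} (hij : i ≠ j) :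
    ⟪Torus.latticeVec (Pi.single j (1 : ℤ) : Fin 3 → ℤ), EuclideanSpace.single i (1 : ℝ)⟫_ℝ = 0 := by
  rw [Torus.latticeVec_single, EuclideanSpace.inner_single_left, PiLp.single_apply, if_neg hij.symm,
    mul_zero]

/-- A single Galloway–Proctor mode `sin(2π x_j) e_i`, `i ≠ j`, is smooth, divergence free and mean
zero. [folklore] -/
theorem gpMode_admissible {i j : Fin 3} (hij : i ≠ j) :
    Torus.IsSmooth ⇑(Torus.stokesMode (Pi.single j (1 : ℤ)) (EuclideanSpace.single i (1 : ℝ)) false) ∧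
      Torus.IsDivFree ⇑(Torus.stokesMode (Pi.single j (1 : ℤ)) (EuclideanSpace.single i (1 : ℝ)) false) ∧
      Torus.HasZeroMean
        ⇑(Torus.stokesMode (Pi.single j (1 : ℤ)) (EuclideanSpace.single i (1 : ℝ)) false) :=
  ⟨Torus.isSmooth_stokesMode _ _ _, Torus.isDivFree_stokesMode (inner_latticeVec_single_eq_zero hij) _,
    Torus.hasZeroMean_stokesMode (single_ne_zero j) _ _⟩

/-! ## The stub -/

/-- **S1 `stub_gpAdmissible`** of line `lojasiewicz-lamb-floor-ladder`: the Galloway–Proctor force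
`f_GP(x) = sin(2πx₂)e₀ + sin(2πx₀)e₁ + sin(2πx₁)e₂`, the inline sum of the three Stokes modes
`Torus.stokesMode e₂ e₀ false + Torus.stokesMode e₀ e₁ false + Torus.stokesMode e₁ e₂ false`, is
smooth, divergence free and mean zero (each mode is, `gpMode_admissible`; the three properties are
additive on smooth fields). [folklore] -/
theorem stub_gpAdmissible :
    Torus.IsSmooth (fun x : UnitAddTorus (Fin 3) =>
        (Torus.stokesMode (Pi.single (2 : Fin 3) (1 : ℤ)) (EuclideanSpace.single (0 : Fin 3) (1 : ℝ)) false x +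
          Torus.stokesMode (Pi.single (0 : Fin 3) (1 : ℤ)) (EuclideanSpace.single (1 : Fin 3) (1 : ℝ)) false x +
          Torus.stokesMode (Pi.single (1 : Fin 3) (1 : ℤ)) (EuclideanSpace.single (2 : Fin 3) (1 : ℝ)) false x :
          EuclideanSpace ℝ (Fin 3))) ∧
      Torus.IsDivFree (fun x : UnitAddTorus (Fin 3) =>
        (Torus.stokesMode (Pi.single (2 : Fin 3) (1 : ℤ)) (EuclideanSpace.single (0 : Fin 3) (1 : ℝ)) false x +
          Torus.stokesMode (Pi.single (0 : Fin 3) (1 : ℤ)) (EuclideanSpace.single (1 : Fin 3) (1 : ℝ)) false x +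
          Torus.stokesMode (Pi.single (1 : Fin 3) (1 : ℤ)) (EuclideanSpace.single (2 : Fin 3) (1 : ℝ)) false x :
          EuclideanSpace ℝ (Fin 3))) ∧
      Torus.HasZeroMean (fun x : UnitAddTorus (Fin 3) =>
        (Torus.stokesMode (Pi.single (2 : Fin 3) (1 : ℤ)) (EuclideanSpace.single (0 : Fin 3) (1 : ℝ)) false x +
          Torus.stokesMode (Pi.single (0 : Fin 3) (1 : ℤ)) (EuclideanSpace.single (1 : Fin 3) (1 : ℝ)) false x +
          Torus.stokesMode (Pi.single (1 : Fin 3) (1 : ℤ)) (EuclideanSpace.single (2 : Fin 3) (1 : ℝ)) false x :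
          EuclideanSpace ℝ (Fin 3))) := by
  obtain ⟨h1s, h1d, h1z⟩ := gpMode_admissible (i := (0 : Fin 3)) (j := (2 : Fin 3)) (by decide)
  obtain ⟨h2s, h2d, h2z⟩ := gpMode_admissible (i := (1 : Fin 3)) (j := (0 : Fin 3)) (by decide)
  obtain ⟨h3s, h3d, h3z⟩ := gpMode_admissible (i := (2 : Fin 3)) (j := (1 : Fin 3)) (by decide)
  have h12s : Torus.IsSmooth (fun x : UnitAddTorus (Fin 3) =>
      (Torus.stokesMode (Pi.single (2 : Fin 3) (1 : ℤ)) (EuclideanSpace.single (0 : Fin 3) (1 : ℝ)) false x +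
        Torus.stokesMode (Pi.single (0 : Fin 3) (1 : ℤ)) (EuclideanSpace.single (1 : Fin 3) (1 : ℝ)) false x :
        EuclideanSpace ℝ (Fin 3))) := h1s.add h2s
  exact ⟨h12s.add h3s, isDivFree_add h12s h3s (isDivFree_add h1s h2s h1d h2d) h3d,
    hasZeroMean_add h12s h3s (hasZeroMean_add h1s h2s h1z h2z) h3z⟩

end Summit.AnomalousDissipation.AnomalousDissipation.Theorems.SteadyStatesLoudBounded.GpAdmissible
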